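import Summits.SmoothPoincare4.SmoothPoincare4.Theses.WeakReductionDescent
import Literature.Topology.FourManifolds.GenusThreePrimitiveOrReducing
import Literature.Topology.FourManifolds.DependentTripleGenusThreeTrisectionsProofs
import Literature.Topology.FourManifolds.HomotopyS4OrientableProofs

/-!
# Crux `WeakReductionDescent.DependentTripleGenusThreeStandard` (stmt-SmoothPoincare4-18000), line
# `Sketch`, skeleton v11: the pants case downstream of the Aranda–Zupan Lemma 3.7 fact

Reduction glue for the registered skeleton v11 of the crux (`Cruxes/…/Lines/Sketch.lean`), filed
`--supports stmt-SmoothPoincare4-18000` (registered helper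
`helper_loopPartnerNoRange_of_primitiveOrReducing_of_duals`; the five-stub reduction of the crux
BY NAME follows in `…SketchReductionNine.lean`).  Everything here is PROVED.

v11 has five stubs, four of which are NAMED LITERATURE FACTS — Aranda–Zupan 2025 Thm 1.3
(hs-corollary, `Literature.Barriers.SmoothPoincare4.az2025_weaklyReducible_genusThree_homotopySphere_gk`),
Meier–Schirmer–Zupan 2016 Thm 1.2 (`msz_trisection_classification_gk`), Aranda–Zupan Lemma 3.8
on genus-three spines (`arandaZupan_separatingPair_reducing_gk`, p172489) and Lemma 3.7 on
genus-three spines (`arandaZupan_nonSeparatingPair_primitiveOrReducing_gk`, p172829, with the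
predicate `Trisection.MeetsOnceTransv` for "`|c ∩ c′| = 1`") — and one apex, the DIAGRAMMATIC
core of Aranda–Zupan's §7 case (3) (arXiv:2503.04607, pp. 25–26): *a `(3; 1,1,1)`-trisected
`M ≃ₕ S⁴` with a pants-type triple that is not weakly reducible, given for every ordered pair of
cuffs a dual compressing curve as Lemma 3.7 (1)/(2) supplies it, is a circle surgery on a loop of
a smooth `X′` GK-trisected in genus `≤ 2`* (slides to a five-chain, Lemma 5.4, Prop. 5.5).

* `helper_loopPartnerNoRange_of_primitiveOrReducing_of_duals` — the Lemma 3.7 fact and that apex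
  give v9's loop-partner stub (the fourth hypothesis of
  `helper_dependentTripleGenusThreeStandard_of_four_v9`): for each ordered pair `i ≠ j` apply
  Lemma 3.7 to the splitting `H_i ∪_F H_j = ∂X_l` (`k_l = 1`; `M ≃ₕ S⁴` is orientable);
  alternatives (3)/(4) put `f i` in `H_j` or `f j` in `H_i`, and the third curve `f l ⊂ H_l`
  completes a weak reduction (`isWeaklyReducible_of_boundsDisc_two`) — "If any of the curves
  bounds a disk in another handlebody, then the splitting is weakly reducible" (p. 25) —
  contradicting `¬ IsWeaklyReducible`; so (1)/(2) hold for every pair.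

References: R. Aranda, A. Zupan, arXiv:2503.04607 (2025), Lemma 3.7 (p. 9), §7 (pp. 25–26).
-/

noncomputable section

set_option linter.dupNamespace false

open scoped Manifold ContDiff Topology ContinuousMap
open Set
open Literature.Topology.FourManifolds
open Literature.Topology.FourManifolds.Trisection

namespace Summit.SmoothPoincare4.SmoothPoincare4.Theorems

/-- **The loop-partner step of Aranda–Zupan's §7 case (3) from the Lemma 3.7 fact and its
diagrammatic core** (PROVED glue; registered helper of crux stmt-SmoothPoincare4-18000, line
`Sketch`, skeleton v11: stubs 4a + 4b ⟹ v9's stub 4).  For each ordered pair `i ≠ j` of cuffs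
of the pants-type triple `f` apply `arandaZupan_nonSeparatingPair_primitiveOrReducing_gk` to the
genus-three splitting `H_i ∪_F H_j = ∂X_l` (`k_l = 1`; `M ≃ₕ S⁴` is orientable by
`isOrientable_of_homotopyEquiv_sphere_four_holds`): alternatives (3)/(4) — `f i` compresses in
`H_j`, or `f j` in `H_i` — together with the third curve `f l ⊂ H_l` make `T` weakly reducible
(`isWeaklyReducible_of_boundsDisc_two`; "If any of the curves bounds a disk in another
handlebody, then the splitting is weakly reducible", p. 25), contradicting the hypothesis; hence
the duals of (1)/(2) exist for every pair and the core applies.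
[cite: ArandaZupan2025, §7 (p. 25) and Lemma 3.7 (p. 9)] -/
theorem helper_loopPartnerNoRange_of_primitiveOrReducing_of_duals :
    arandaZupan_nonSeparatingPair_primitiveOrReducing_gk.{0} →
    (∀ (M : Type) [TopologicalSpace M] [T2Space M] [SecondCountableTopology M]
      [ChartedSpace (EuclideanSpace ℝ (Fin 4)) M] [IsManifold (𝓡 4) ∞ M],
      M ≃ₕ (Metric.sphere (0 : EuclideanSpace ℝ (Fin 5)) 1) → ∀ T : Fin 3 → Set M,
      IsGKTrisection M 3 (fun _ => 1) T →
      ∀ f : Fin 3 → Set M,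
      ((∀ i, IsCurve T (f i)) ∧ (Pairwise fun i j => Disjoint (f i) (f j)) ∧
        (∀ i, IsNonSeparating T (f i)) ∧ (∀ i, BoundsDisc T (spineHandlebody T i) (f i)) ∧
        (∀ i j, i ≠ j → IsConnected (centralSurfaceSet T \ (f i ∪ f j))) ∧
        ¬ IsPreconnected (centralSurfaceSet T \ ⋃ i, f i)) →
      ¬ IsWeaklyReducible T →
      (∀ i j : Fin 3, i ≠ j →
        (∃ y' : Set M, IsCurve T y' ∧ BoundsDisc T (spineHandlebody T j) y' ∧
          MeetsOnceTransv y' (f i) ∧ Disjoint y' (f j)) ∨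
        (∃ x' : Set M, IsCurve T x' ∧ BoundsDisc T (spineHandlebody T i) x' ∧
          MeetsOnceTransv x' (f j) ∧ Disjoint x' (f i))) →
      ∃ (X' : Type) (_ : TopologicalSpace X') (_ : T2Space X') (_ : SecondCountableTopology X')
        (_ : ChartedSpace (EuclideanSpace ℝ (Fin 4)) X') (_ : IsManifold (𝓡 4) ∞ X')
        (g' : ℕ) (k' : Fin 3 → ℕ) (T' : Fin 3 → Set X')
        (ℓ : Metric.sphere (0 : EuclideanSpace ℝ (Fin 2)) 1 → X'),
        g' ≤ 2 ∧ IsGKTrisection X' g' k' T' ∧ IsCircleSurgery (𝓡 4) (𝓡 4) X' M ℓ) →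
    ∀ (M : Type) [TopologicalSpace M] [T2Space M] [SecondCountableTopology M]
      [ChartedSpace (EuclideanSpace ℝ (Fin 4)) M] [IsManifold (𝓡 4) ∞ M],
      M ≃ₕ (Metric.sphere (0 : EuclideanSpace ℝ (Fin 5)) 1) → ∀ T : Fin 3 → Set M,
      IsGKTrisection M 3 (fun _ => 1) T →
      ∀ f : Fin 3 → Set M,
      ((∀ i, IsCurve T (f i)) ∧ (Pairwise fun i j => Disjoint (f i) (f j)) ∧
        (∀ i, IsNonSeparating T (f i)) ∧ (∀ i, BoundsDisc T (spineHandlebody T i) (f i)) ∧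
        (∀ i j, i ≠ j → IsConnected (centralSurfaceSet T \ (f i ∪ f j))) ∧
        ¬ IsPreconnected (centralSurfaceSet T \ ⋃ i, f i)) →
      ¬ IsWeaklyReducible T →
      ∃ (X' : Type) (_ : TopologicalSpace X') (_ : T2Space X') (_ : SecondCountableTopology X')
        (_ : ChartedSpace (EuclideanSpace ℝ (Fin 4)) X') (_ : IsManifold (𝓡 4) ∞ X')
        (g' : ℕ) (k' : Fin 3 → ℕ) (T' : Fin 3 → Set X')
        (ℓ : Metric.sphere (0 : EuclideanSpace ℝ (Fin 2)) 1 → X'),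
        g' ≤ 2 ∧ IsGKTrisection X' g' k' T' ∧ IsCircleSurgery (𝓡 4) (𝓡 4) X' M ℓ := by
  intro h37 h4b M _ _ _ _ _ e T hT f hf hwr
  obtain ⟨hcur, hdis, hns, hbd, hconn, hdep⟩ := hf
  have hM : IsOrientable (𝓡 4) M := isOrientable_of_homotopyEquiv_sphere_four_holds M e
  have third : ∀ i j : Fin 3, i ≠ j → ∃ l : Fin 3, l ≠ i ∧ l ≠ j := by decide
  refine h4b M e T hT f ⟨hcur, hdis, hns, hbd, hconn, hdep⟩ hwr fun i j hij => ?_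
  obtain ⟨l, hli, hlj⟩ := third i j hij
  rcases h37 M hM (fun _ => 1) T hT i j l hij hli hlj le_rfl (f i) (f j) (hcur i) (hcur j)
      (hdis hij) (hns i) (hns j) (hconn i j hij) (hbd i) (hbd j) with h | h | h | h
  · exact Or.inl h
  · exact Or.inr h
  · -- (3): `f i` compresses in `H_i` and `H_j`; `f l ⊂ H_l` completes a weak reduction
    exact absurd (isWeaklyReducible_of_boundsDisc_two (p := l) (i := i) (j := j) hij hli.symm
      hlj.symm (hcur l) (hcur i) (hdis hli) (hns l) (hns i) (hbd l) (hbd i) h) hwr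
  · -- (4): `f j` compresses in `H_j` and `H_i`
    exact absurd (isWeaklyReducible_of_boundsDisc_two (p := l) (i := j) (j := i) hij.symm hlj.symm
      hli.symm (hcur l) (hcur j) (hdis hlj) (hns l) (hns j) (hbd l) (hbd j) h) hwr

end Summit.SmoothPoincare4.SmoothPoincare4.Theorems

end
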